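import Summits.QuantumAdvantage.QuantumAdvantage.Theses.ArithStatLadder
import Literature.NumberTheory.QuadraticFields.ThreeTorsion
import Literature.Computability.Complexity.ACRealize

/-!
# `AcZeroRung` (stmt-QuantumAdvantage-2425) — LOAD-BEARING analysis, tightness, ladder

Support / negative lemmas for the crux `ArithStatLadder.AcZeroRung` (the AC⁰ rung: the centred
3-torsion `t(-d) - 2` of `Cl(ℚ(√-d))` has `o(#𝒟_n)` correlation with every constant-depth
polynomial-size circuit in the binary digits of `d`, along `n`-bit fundamental `-d`), extracted
from the refuter work file `Summits/QuantumAdvantage/QuantumAdvantage/Cruxes/AcZeroRung/Disproof.lean`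
(refuter-cdisprove-stmt-QuantumAdvantage-2425-0, cycle 1) so that provers, planners and ideators
can IMPORT them. Sorry-free; nothing here asserts a Theses statement.

* §0 vocabulary: `NegFund`, `famD` (`𝒟_n`, verbatim the route's finset), `Pins` (the route's
  `t`-hypothesis), `corrSum`, the schema `AcZeroRungCentred c` and
  `acZeroRung_iff : AcZeroRung ↔ AcZeroRungCentred 2` (`Iff.rfl`).
* §1 the hypothesis: `pins_iff_eqOn_fund` (`Pins t` ⇔ `t = quadFieldThreeTorsion` on fundamental
  discriminants — satisfiable, by `quadFieldThreeTorsion_spec` (the deprecated alias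
  `pins_quadFieldThreeTorsion`), so the crux is not vacuous; and `t` is
  FREE elsewhere), `one_le_abs_sub_two_of_pins` (`3^r ≠ 2`), `famD_nonempty` (`n ≥ 6`).
* §2 LOAD-BEARING (centring): `acZeroRungCentred_false_of_lt_one` / `centre_unique` /
  `dyadicMean_of_acZeroRungCentred` (the centring constant is forced; `AcZeroRung → DyadicMean 2`,
  the dyadic Davenport–Heilbronn mean, so `¬ DyadicMean 2 → ¬ AcZeroRung`).

Sequel `SizeFundLadder.lean`: the size bound and the fundamental filter are load-bearing
(`acZeroRung_false_without_size`, `acZeroRung_false_without_fund`), tightness at depth 2, and the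
ladder `¬ DigitRung → ¬ AcZeroRung`.
-/

set_option linter.dupNamespace false

open scoped BigOperators Classical
open Filter Finset
open Literature.NumberTheory.QuadraticFields
open Literature.Computability.Complexity
open Literature.Probability.RandomGraphs.LowDegree (sgn sgn_true sgn_false)

noncomputable section

namespace Summit.QuantumAdvantage.QuantumAdvantage.Theorems.AcZeroRung.Negative

/-! ### The crux, kept under its name (fullbuild repair 2026-08-17)

The crux `AcZeroRung` (stmt-QuantumAdvantage-2425) and its sibling `DigitRung` were DROPPED from route
`ArithStatLadder` at rev 3 (2026-08-16T06:37Z, unused-crux repair; stmt-2425 closed `moot`), so the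
gate-written route file `Theses/ArithStatLadder.lean` no longer declares
`Theses.ArithStatLadder.AcZeroRung` / `.DigitRung`, and this file's `open … (AcZeroRung DigitRung)`
together with the three uses of `AcZeroRung` below stopped elaborating (full builds since
2026-08-16T19:45Z).  The item's ledger signature (formerly the body of the Theses `def`) is kept here
VERBATIM as the `@[conjecture] def Negative.AcZeroRung : Prop` (an open named statement, never
asserted; CONVENTIONS §4), exactly as for `FiniteTangentModuliMild` in
`NavierStokesRegularity/…/Theorems/FiniteTangentModuliMild/Negative/TrivialSectors.lean`; the stale
`open` line is gone (`DigitRung` was never used here).  No other declaration changed; `acZeroRung_iff`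
is still `Iff.rfl`, confirming the copy is verbatim. -/

/-- **The crux `AcZeroRung`** (stmt-QuantumAdvantage-2425; ledger signature verbatim; formerly
`Theses.ArithStatLadder.AcZeroRung`, DROPPED from the route at rev 3 and closed `moot` — kept here
under its name as an `@[conjecture] def`, an unproved statement being a `Prop`, never a theorem; use
only as a hypothesis or inside `↔`/`¬`): the AC⁰ rung — along `n`-bit `d` with `-d` fundamental,
the centred 3-torsion statistic `t(-d) - 2` of `Cl(ℚ(√-d))` (with `t` pinned to `#Cl(K)[3]` on
quadratic fields) has `o(#𝒟_n)` correlation with every constant-depth polynomial-size `acBasis`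
circuit in the binary digits of `d`.  POSED in this project (route route-QuantumAdvantage-ArithStatLadder).
[folklore] -/
@[conjecture] def AcZeroRung : Prop :=
  ∀ t : ℤ → ℕ, (∀ (D : ℤ) (K : Type) [Field K] [NumberField K], Module.finrank ℚ K = 2 → NumberField.discr K = D → t D = Nat.card {c : ClassGroup (NumberField.RingOfIntegers K) // c ^ 3 = 1}) → ∀ k : ℕ, ∀ p : Polynomial ℕ, ∀ ε : ℝ, 0 < ε → ∀ᶠ n : ℕ in Filter.atTop, ∀ C : Literature.Computability.Complexity.Circuit (Fin n), C.IsOver Literature.Computability.Complexity.acBasis → C.acDepth ≤ k → C.size ≤ p.eval n → |∑ d ∈ ((Finset.Ico (2 ^ (n - 1)) (2 ^ n)).filter (fun d : ℕ => (((-(d:ℤ)) % 4 = 1 ∧ Squarefree (-(d:ℤ)) ∧ (-(d:ℤ)) ≠ 1) ∨ (4 ∣ (-(d:ℤ)) ∧ ((-(d:ℤ)) / 4 % 4 = 2 ∨ (-(d:ℤ)) / 4 % 4 = 3) ∧ Squarefree ((-(d:ℤ)) / 4))))), ((t (-(d:ℤ)) : ℝ) - 2) * Literature.Probability.RandomGraphs.LowDegree.sgn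 (C.eval (fun i : Fin n => Nat.testBit d i))| ≤ ε * (((Finset.Ico (2 ^ (n - 1)) (2 ^ n)).filter (fun d : ℕ => (((-(d:ℤ)) % 4 = 1 ∧ Squarefree (-(d:ℤ)) ∧ (-(d:ℤ)) ≠ 1) ∨ (4 ∣ (-(d:ℤ)) ∧ ((-(d:ℤ)) / 4 % 4 = 2 ∨ (-(d:ℤ)) / 4 % 4 = 3) ∧ Squarefree ((-(d:ℤ)) / 4))))).card : ℝ)

/-! ### The statement, unfolded -/

/-- `-d` is a fundamental discriminant — verbatim the route's inline filter. [folklore] -/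
def NegFund (d : ℕ) : Prop :=
  ((-(d:ℤ)) % 4 = 1 ∧ Squarefree (-(d:ℤ)) ∧ (-(d:ℤ)) ≠ 1) ∨
    (4 ∣ (-(d:ℤ)) ∧ ((-(d:ℤ)) / 4 % 4 = 2 ∨ (-(d:ℤ)) / 4 % 4 = 3) ∧ Squarefree ((-(d:ℤ)) / 4))

/-- The family `𝒟_n` of `n`-bit `d` with `-d` fundamental — verbatim the route's finset. [folklore] -/
def famD (n : ℕ) : Finset ℕ :=
  (Finset.Ico (2 ^ (n - 1)) (2 ^ n)).filter (fun d : ℕ => (((-(d:ℤ)) % 4 = 1 ∧ Squarefree (-(d:ℤ)) ∧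
    (-(d:ℤ)) ≠ 1) ∨ (4 ∣ (-(d:ℤ)) ∧ ((-(d:ℤ)) / 4 % 4 = 2 ∨ (-(d:ℤ)) / 4 % 4 = 3) ∧
      Squarefree ((-(d:ℤ)) / 4))))

/-- The route's hypothesis on the statistic `t`: it is `#Cl(K)[3]` on every quadratic field. [folklore] -/
def Pins (t : ℤ → ℕ) : Prop :=
  ∀ (D : ℤ) (K : Type) [Field K] [NumberField K], Module.finrank ℚ K = 2 → NumberField.discr K = D →
    t D = Nat.card {c : ClassGroup (NumberField.RingOfIntegers K) // c ^ 3 = 1}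

/-- The correlation sum of `t(-d) - c` with `sgn ∘ C` over `𝒟_n` (the crux has `c = 2`). [folklore] -/
noncomputable def corrSum (t : ℤ → ℕ) (c : ℝ) (n : ℕ) (C : Circuit (Fin n)) : ℝ :=
  ∑ d ∈ famD n, ((t (-(d:ℤ)) : ℝ) - c) * sgn (C.eval (fun i : Fin n => Nat.testBit d i))

/-- The crux with a general centring constant `c` (the crux is `c = 2`). [folklore] -/
def AcZeroRungCentred (c : ℝ) : Prop :=
  ∀ t : ℤ → ℕ, Pins t → ∀ k : ℕ, ∀ p : Polynomial ℕ, ∀ ε : ℝ, 0 < ε → ∀ᶠ n : ℕ in atTop,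
    ∀ C : Circuit (Fin n), C.IsOver acBasis → C.acDepth ≤ k → C.size ≤ p.eval n →
      |corrSum t c n C| ≤ ε * ((famD n).card : ℝ)

/-- READ-BACK: the crux is literally `AcZeroRungCentred 2`. [folklore] -/
theorem acZeroRung_iff : AcZeroRung ↔ AcZeroRungCentred 2 := Iff.rfl

/-! ### The `t`-hypothesis: satisfiable, and pins `t` exactly on fundamental discriminants -/

/-- The hypothesis is satisfiable (so the crux is not vacuously true): the tree function
`quadFieldThreeTorsion` is pinned — this is verbatim the Literature fact `quadFieldThreeTorsion_spec`
(`Pins quadFieldThreeTorsion` unfolds to it), which the proofs below now use directly.  Deprecated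
2026-08-17 (gate dedup): the same statement had landed meanwhile as
`Summit.QuantumAdvantage.DigitRung.Negative.pins_canonical` (that line's twin `Pins`); the old name is
kept (append-only) as an alias of the Literature fact. [folklore] -/
@[deprecated quadFieldThreeTorsion_spec (since := "2026-08-17")]
alias pins_quadFieldThreeTorsion := Literature.NumberTheory.QuadraticFields.quadFieldThreeTorsion_spec

/-- `Pins t` says exactly: `t = quadFieldThreeTorsion` on fundamental discriminants (and nothing
elsewhere). [folklore] -/
theorem pins_iff_eqOn_fund (t : ℤ → ℕ) : Pins t ↔ ∀ D : ℤ,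
    ((D % 4 = 1 ∧ Squarefree D ∧ D ≠ 1) ∨ (4 ∣ D ∧ (D / 4 % 4 = 2 ∨ D / 4 % 4 = 3) ∧ Squarefree (D / 4))) →
      t D = quadFieldThreeTorsion D := by
  constructor
  · intro h D hD
    obtain ⟨K, _, _, h2, hdisc⟩ := (Quadratic.isFundamental_iff_exists_discr_eq D).mp hD
    rw [h D K h2 hdisc, quadFieldThreeTorsion_eq D K h2 hdisc]
  · intro h D K _ _ h2 hdisc
    subst hdisc
    rw [h _ (Quadratic.isFundamentalDiscriminant_discr h2), quadFieldThreeTorsion_eq _ K h2 rfl]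

/-- Membership in `𝒟_n`, unfolded. [folklore] -/
theorem mem_famD {n d : ℕ} : d ∈ famD n ↔ (2 ^ (n - 1) ≤ d ∧ d < 2 ^ n) ∧ NegFund d := by
  simp only [famD, NegFund, Finset.mem_filter, Finset.mem_Ico]

/-- On the family, a pinned `t` is a power of `3`. [folklore] -/
theorem exists_eq_three_pow_of_pins {t : ℤ → ℕ} (ht : Pins t) {n d : ℕ} (hd : d ∈ famD n) :
    ∃ r : ℕ, t (-(d:ℤ)) = 3 ^ r := by
  rw [(pins_iff_eqOn_fund t).mp ht _ (mem_famD.mp hd).2]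
  exact exists_quadFieldThreeTorsion_eq_pow _

/-- Hence `1 ≤ t(-d)` on the family. [folklore] -/
theorem one_le_of_pins {t : ℤ → ℕ} (ht : Pins t) {n d : ℕ} (hd : d ∈ famD n) :
    (1 : ℝ) ≤ (t (-(d:ℤ)) : ℝ) := by
  obtain ⟨r, hr⟩ := exists_eq_three_pow_of_pins ht hd
  rw [hr]; exact_mod_cast Nat.one_le_pow r 3 (by norm_num)

/-- … and `t(-d) ≠ 2`, quantitatively `1 ≤ |t(-d) - 2|` (`3^r ≠ 2`). [folklore] -/
theorem one_le_abs_sub_two_of_pins {t : ℤ → ℕ} (ht : Pins t) {n d : ℕ} (hd : d ∈ famD n) :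
    (1 : ℝ) ≤ |(t (-(d:ℤ)) : ℝ) - 2| := by
  obtain ⟨r, hr⟩ := exists_eq_three_pow_of_pins ht hd
  rw [hr]
  rcases Nat.eq_zero_or_pos r with rfl | hr0
  · norm_num
  · have h3 : (3 : ℝ) ≤ (3 : ℝ) ^ r := by
      calc (3 : ℝ) = 3 ^ 1 := by norm_num
        _ ≤ 3 ^ r := pow_le_pow_right₀ (by norm_num) hr0
    rw [abs_of_nonneg (by push_cast; linarith)]
    push_cast; linarith

/-! ### `𝒟_n` is nonempty for `n ≥ 6` -/

/-- `d = 8p`, `p` an odd prime, has `-d` fundamental (`-d = 4·(-2p)`, `-2p ≡ 2 (mod 4)`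
squarefree). [folklore] -/
theorem negFund_eight_mul {p : ℕ} (hp : p.Prime) (hp2 : p ≠ 2) : NegFund (8 * p) := by
  right
  obtain ⟨k, hk⟩ := hp.odd_of_ne_two hp2
  have hdiv : (-((8 * p : ℕ) : ℤ)) / 4 = -(2 * p) := by
    rw [show (-((8 * p : ℕ) : ℤ)) = 4 * (-(2 * p)) by push_cast; ring]
    exact Int.mul_ediv_cancel_left _ (by norm_num)
  refine ⟨⟨-(2 * p), by push_cast; ring⟩, ?_, ?_⟩
  · left
    rw [hdiv, hk]; push_cast; omega
  · rw [hdiv, ← Int.squarefree_natAbs, Int.natAbs_neg,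
      show ((2 * p : ℤ)).natAbs = 2 * p by push_cast [Int.natAbs_mul, Int.natAbs_natCast]; rfl,
      Nat.squarefree_mul_iff]
    exact ⟨(Nat.coprime_primes Nat.prime_two hp).mpr (Ne.symm hp2), Nat.prime_two.squarefree,
      hp.squarefree⟩

/-- **`𝒟_n ≠ ∅` for `n ≥ 6`** (Bertrand: a prime `2^{n-4} < p < 2^{n-3}`, then `d = 8p`). So the
rungs are not vacuous in `n`. [folklore] -/
theorem famD_nonempty {n : ℕ} (hn : 6 ≤ n) : (famD n).Nonempty := by
  obtain ⟨m, rfl⟩ : ∃ m, n = m + 4 := ⟨n - 4, by omega⟩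
  obtain ⟨p, hp, hlt, hle⟩ := Nat.exists_prime_lt_and_le_two_mul (2 ^ m) (by positivity)
  have hm : 4 ≤ 2 ^ m := by
    calc 4 = 2 ^ 2 := by norm_num
      _ ≤ 2 ^ m := Nat.pow_le_pow_right (by norm_num) (by omega)
  have hp2 : p ≠ 2 := by omega
  have hplt : p < 2 * 2 ^ m := by
    refine lt_of_le_of_ne hle fun h => hp2 ?_
    have h2 : 2 ∣ p := ⟨2 ^ m, h⟩
    exact ((hp.eq_one_or_self_of_dvd 2 h2).resolve_left (by norm_num)).symm
  refine ⟨8 * p, mem_famD.mpr ⟨⟨?_, ?_⟩, negFund_eight_mul hp hp2⟩⟩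
  · rw [show m + 4 - 1 = m + 3 by omega, pow_succ, pow_succ, pow_succ]; omega
  · rw [pow_succ, pow_succ, pow_succ, pow_succ]; omega

/-! ### Constant circuits: the centring constant is forced; `AcZeroRung → DyadicMean 2` -/

/-- A constant circuit over `acBasis` of depth `≤ 1` and size `≤ 1` (tree: `acReal_const`, gate
`∧₀`/`∨₀`). [folklore] -/
theorem exists_const_circuit (n : ℕ) (b : Bool) : ∃ C : Circuit (Fin n),
    C.IsOver acBasis ∧ C.acDepth ≤ 1 ∧ C.size ≤ 1 ∧ ∀ x, C.eval x = b :=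
  (acReal_const b).toCircuit

/-- On a constant circuit the correlation sum is `± ∑ (t - c)`. [folklore] -/
theorem corrSum_of_eval_const {t : ℤ → ℕ} {c : ℝ} {n : ℕ} {C : Circuit (Fin n)} {b : Bool}
    (hC : ∀ x, C.eval x = b) :
    corrSum t c n C = sgn b * ∑ d ∈ famD n, ((t (-(d:ℤ)) : ℝ) - c) := by
  simp only [corrSum, hC, Finset.mul_sum]
  exact Finset.sum_congr rfl fun _ _ => mul_comm _ _

/-- The constant-false circuit instance of a centred rung: eventually `|∑_{𝒟_n} (t - c)| ≤ ε #𝒟_n`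
together with `6 ≤ n`. [folklore] -/
theorem eventually_abs_sum_sub_le {c : ℝ} (h : AcZeroRungCentred c) {t : ℤ → ℕ} (ht : Pins t)
    {ε : ℝ} (hε : 0 < ε) :
    ∀ᶠ n : ℕ in atTop, 6 ≤ n ∧ |∑ d ∈ famD n, ((t (-(d:ℤ)) : ℝ) - c)| ≤ ε * ((famD n).card : ℝ) := by
  filter_upwards [eventually_ge_atTop 6, h t ht 1 1 ε hε] with n hn6 hn
  refine ⟨hn6, ?_⟩
  obtain ⟨C, hB, hd, hs, hev⟩ := exists_const_circuit n false
  have := hn C hB hd (by simpa using hs)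
  rwa [corrSum_of_eval_const hev, sgn_false, one_mul] at this

/-- `#𝒟_n > 0` as a real number, `n ≥ 6`. [folklore] -/
theorem card_famD_pos {n : ℕ} (hn : 6 ≤ n) : (0 : ℝ) < ((famD n).card : ℝ) := by
  exact_mod_cast (famD_nonempty hn).card_pos

/-- **(a) The centring constant is load-bearing and FORCED**: two centred rungs can only hold for
the same constant (compare the constant circuit for both; `𝒟_n ≠ ∅`). [folklore] -/
theorem centre_unique {c c' : ℝ} (h : AcZeroRungCentred c) (h' : AcZeroRungCentred c') : c = c' := by
  by_contra hne
  have hpos : 0 < |c - c'| := abs_pos.mpr (sub_ne_zero.mpr hne)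
  have hε : 0 < |c - c'| / 4 := by positivity
  obtain ⟨n, ⟨hn6, hn⟩, -, hn'⟩ :=
    ((eventually_abs_sum_sub_le h (t := quadFieldThreeTorsion) quadFieldThreeTorsion_spec hε).and
      (eventually_abs_sum_sub_le h' (t := quadFieldThreeTorsion) quadFieldThreeTorsion_spec hε)).exists
  have hcard := card_famD_pos hn6
  set S := ∑ d ∈ famD n, ((quadFieldThreeTorsion (-(d:ℤ)) : ℝ) - c) with hS
  set S' := ∑ d ∈ famD n, ((quadFieldThreeTorsion (-(d:ℤ)) : ℝ) - c') with hS'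
  have hdiff : S - S' = (c' - c) * ((famD n).card : ℝ) := by
    rw [hS, hS', ← Finset.sum_sub_distrib, Finset.sum_congr rfl fun d _ => sub_sub_sub_cancel_left _ _ _,
      Finset.sum_const, nsmul_eq_mul, mul_comm]
  have key : |c' - c| * ((famD n).card : ℝ) ≤ 2 * (|c - c'| / 4) * ((famD n).card : ℝ) := by
    calc |c' - c| * ((famD n).card : ℝ) = |S - S'| := by
          rw [hdiff, abs_mul, abs_of_pos hcard]
      _ ≤ |S| + |S'| := abs_sub _ _
      _ ≤ _ := by linarith
  rw [abs_sub_comm] at key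
  nlinarith

/-- **(a) Dropping the centring (or any centre `c < 1`) makes the rung FALSE**: on the constant
circuit `∑ (t - c) ≥ (1 - c) #𝒟_n` since `t ≥ 1`. [folklore] -/
theorem acZeroRungCentred_false_of_lt_one {c : ℝ} (hc : c < 1) : ¬ AcZeroRungCentred c := by
  intro h
  have hε : 0 < (1 - c) / 2 := by linarith
  obtain ⟨n, hn6, hn⟩ := (eventually_abs_sum_sub_le h (t := quadFieldThreeTorsion) quadFieldThreeTorsion_spec hε).exists
  have hcard := card_famD_pos hn6
  have hge : (1 - c) * ((famD n).card : ℝ) ≤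
      ∑ d ∈ famD n, ((quadFieldThreeTorsion (-(d:ℤ)) : ℝ) - c) := by
    calc (1 - c) * ((famD n).card : ℝ) = ∑ d ∈ famD n, (1 - c) := by
          rw [Finset.sum_const, nsmul_eq_mul, mul_comm]
      _ ≤ _ := Finset.sum_le_sum fun d hd => by
          linarith [one_le_of_pins (t := quadFieldThreeTorsion) quadFieldThreeTorsion_spec hd]
  have := (le_abs_self _).trans hn
  nlinarith

/-- In particular the UNCENTRED rung (`c = 0`: "`t` itself is AC⁰-pseudorandom") is false. [folklore] -/
theorem acZeroRung_false_uncentred : ¬ AcZeroRungCentred 0 :=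
  acZeroRungCentred_false_of_lt_one one_pos

/-- The dyadic Davenport–Heilbronn mean for the statistic `quadFieldThreeTorsion`:
`∑_{d ∈ 𝒟_n} #Cl₃(-d) / #𝒟_n → c` along `n → ∞` (in print with `c = 2`: BST Cor. 7 differenced
over `[2^{n-1}, 2^n)`, or `btt_threeTorsion_sum` of `ThreeTorsionMean.lean`; NOT a theorem of the
tree). [cite: BhargavaShankarTsimerman2012, Cor. 7] -/
def DyadicMean (c : ℝ) : Prop :=
  Tendsto (fun n : ℕ => (∑ d ∈ famD n, (quadFieldThreeTorsion (-(d:ℤ)) : ℝ)) / ((famD n).card : ℝ))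
    atTop (nhds c)

/-- **A centred rung implies the dyadic mean equals its centre** — so `AcZeroRung` CONTAINS the
dyadic Davenport–Heilbronn theorem (any proof of the crux proves `DyadicMean 2`). [folklore] -/
theorem dyadicMean_of_acZeroRungCentred {c : ℝ} (h : AcZeroRungCentred c) : DyadicMean c := by
  rw [DyadicMean, Metric.tendsto_atTop]
  intro ε hε
  obtain ⟨N, hN⟩ := eventually_atTop.mp
    (eventually_abs_sum_sub_le h (t := quadFieldThreeTorsion) quadFieldThreeTorsion_spec (half_pos hε))
  refine ⟨N, fun n hn => ?_⟩
  obtain ⟨hn6, hb⟩ := hN n hn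
  have hcard := card_famD_pos hn6
  rw [Real.dist_eq]
  have hrw : (∑ d ∈ famD n, (quadFieldThreeTorsion (-(d:ℤ)) : ℝ)) / ((famD n).card : ℝ) - c =
      (∑ d ∈ famD n, ((quadFieldThreeTorsion (-(d:ℤ)) : ℝ) - c)) / ((famD n).card : ℝ) := by
    rw [Finset.sum_sub_distrib, Finset.sum_const, nsmul_eq_mul, sub_div,
      mul_div_cancel_left₀ _ hcard.ne']
  rw [hrw, abs_div, abs_of_pos hcard, div_lt_iff₀ hcard]
  linarith [mul_pos hε hcard]

/-- `AcZeroRung → DyadicMean 2`. [folklore] -/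
theorem dyadicMean_two_of_acZeroRung (h : AcZeroRung) : DyadicMean 2 :=
  dyadicMean_of_acZeroRungCentred (acZeroRung_iff.mp h)

/-- Contrapositive, negative lane: a disproof of the dyadic Davenport–Heilbronn mean `2` kills the
crux; equivalently `2` is the only centring for which the crux can hold
(`centre_unique`, `dyadicMean_of_acZeroRungCentred` + uniqueness of limits). [folklore] -/
theorem not_acZeroRung_of_not_dyadicMean_two (h : ¬ DyadicMean 2) : ¬ AcZeroRung :=
  fun hA => h (dyadicMean_two_of_acZeroRung hA)

end Summit.QuantumAdvantage.QuantumAdvantage.Theorems.AcZeroRung.Negative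

end
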